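import Summits.BirchSwinnertonDyer.BirchSwinnertonDyer.Theses.ByReductionTypeAtTwo
import Summits.BirchSwinnertonDyer.BirchSwinnertonDyer.Theses.TwoAdicConverse
import Summits.BirchSwinnertonDyer.BirchSwinnertonDyer.Theorems.ByReductionTypeAtTwoKatoFreeSandwichAssembly
import Summits.BirchSwinnertonDyer.BirchSwinnertonDyer.Theorems.ByReductionTypeAtTwoKatoFreeSandwichImageSplit
import HarnessLib

/-!
# crux-triage r1 seat 1, GEN 13 — refuter probe of the pen's P3 «ORD-MLB TURNKEY» package (RC-331) on the CURRENT tree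

Questions (joint sufficiency at the ROUTE level, by name; no `sorry` — every open input is a HYPOTHESIS):
* (Q1) is the P3 add_item text r212 `OrdLambdaHalfAtTwo` (pasted below BYTE-FOR-BYTE from
  `plan/ordmlb-19577/edit-K4-ordmlb-19577.json`) DEFINITIONALLY the S3 route decl of item 19556 and the Theorems constant the
  landed assembly p668589 consumes?  (String level, checked separately: the 969-character text is byte-identical to the ledger
  `signature` of stmt-BirchSwinnertonDyer-19556, so the gate's dedup attaches K4 as `wanted_by`.)
* (Q2) does the glue r213 `OrdMissingLowerBoundAtTwoOfLambdaHalf`, with the K4 names replaced by their texts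
  (r205 = Abbes–Ullmo by name, r211 = T2 by name, r212 = the text), conclude the ROUTE DECL of 19577 BY FULL NAME from p668589?
* (Q3) axioms of the whole chain ⊆ {propext, Classical.choice, Quot.sound}?
* (Q4, event p671201 `…KatoFreeSandwichImageSplit.lean`, lead g4, 21:47Z) is the `E[2]`-irreducible branch hypothesis
  `hΛirr` LITERALLY the ledger-registered text of 19556's `stub_irreducibleResidual` (skeleton sha f29bb7b89845), elaborated in
  that skeleton's own `open` context (`open …Rank1Residual` for `GoodOrd`, `open …TwoAdicTwistConverse (LambdaHalfAtTwo)`)?  Do the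
  two branch texts re-assemble to r212 (= 19556) definitionally, and does the irreducible branch of 19577 really need only
  PUB ∧ Abbes–Ullmo ∧ that stub (no Cassels, no T2)?
BSD is not proved by any of this; 19577 is not closed; 19556 is not proved; no stub of 19556 is proved.
-/

set_option autoImplicit false

open Literature.NumberTheory.EllipticCurves.ModularForms

namespace TriageR13ProbeP3

/-- BYTE COPY of the P3 add_item statement r212 (`OrdLambdaHalfAtTwo`, kind crux, rank 212). -/
def R212Text : Prop :=
  ∀ (W : WeierstrassCurve ℚ) [W.IsElliptic] [W.IsGloballyMinimal], ¬ W.HasCM → Literature.NumberTheory.EllipticCurves.Rank1Residual.GoodOrd W 2 → ∀ (κ : Literature.NumberTheory.EllipticCurves.ZpExtension ℚ 2) (γ : Field.absoluteGaloisGroup ℚ), κ.IsCyclotomic → κ.IsTopGenerator γ → Literature.NumberTheory.EllipticCurves.IsCyclotomicVariable 2 γ → Literature.NumberTheory.EllipticCurves.IsOrdinaryAt W 2 → ∀ [NeZero (W.conductorNorm ℤ)] (f : CuspForm (CongruenceSubgroup.Gamma0 (W.conductorNorm ℤ)) 2), Literature.NumberTheory.EllipticCurves.ModularForms.IsNewformOf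 W f → ∀ (D : W.SelmerDualData κ γ), ∃ (c : ℚ) (L₀ : Literature.NumberTheory.EllipticCurves.IwasawaAlgebra 2), L₀ ≠ 0 ∧ Literature.NumberTheory.EllipticCurves.iwasawaToPowerSeries 2 L₀ = PowerSeries.C (c : ℚ_[2]) * Literature.NumberTheory.EllipticCurves.padicLFunction f (Literature.NumberTheory.EllipticCurves.unitRoot W 2 : ℚ_[2]) ∧ Summit.BirchSwinnertonDyer.Rank1Residual.X1.MuLambda.lam L₀ ≤ D.lambda

/-- (Q1a) r212 text = S3's route decl of item 19556, definitionally. -/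
theorem r212_iff_routeDecl19556 :
    R212Text ↔ Summit.BirchSwinnertonDyer.BirchSwinnertonDyer.Theses.TwoAdicConverse.OrdLambdaHalfAtTwo := Iff.rfl

/-- (Q1b) r212 text = the Theorems constant consumed by p668589, definitionally. -/
theorem r212_iff_theoremsConst :
    R212Text ↔ Summit.BirchSwinnertonDyer.BirchSwinnertonDyer.Theorems.TwoAdicTwistConverse.OrdLambdaHalfAtTwo := Iff.rfl

/-- (Q2) the glue r213 with K4 names unfolded to their texts, concluding the ROUTE DECL of 19577 by full name. -/
theorem routeDecl19577_of_r213_inputs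
    (hPub : Summit.BirchSwinnertonDyer.BirchSwinnertonDyer.Theses.ByReductionTypeAtTwo.OrdPublishedInputsAtTwo)
    (hIso : Summit.BirchSwinnertonDyer.BirchSwinnertonDyer.Theses.ByReductionTypeAtTwo.OrdIsoPublishedInputsAtTwo)
    (hAU : abbesUllmo_not_dvd_maninConstant_of_not_dvd_level)      -- r205 `OrdKatoIsoPrintedInputsAtTwo` (P2) by name
    (hT2 : exists_optimal_gamma1ParametrizationData)                 -- r211 `OrdMLBPrintedInputsAtTwo` (P3) by name
    (hLam : R212Text) :                                               -- r212 `OrdLambdaHalfAtTwo` (P3) = item 19556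
    Summit.BirchSwinnertonDyer.BirchSwinnertonDyer.Theses.ByReductionTypeAtTwo.OrdMissingLowerBoundAtTwo :=
  Summit.BirchSwinnertonDyer.BirchSwinnertonDyer.Theorems.KatoFreeSandwich.ordMissingLowerBoundAtTwo_of_published_of_lambdaHalf
    hPub hIso.1 hAU hT2 hLam

/-- (Q2') the same, concluding the ITEM's title decl `Theorems.OrdHalvesAtTwo.OrdMissingLowerBoundAtTwo` (alias, `Iff.rfl`). -/
theorem itemDecl19577_of_r213_inputs
    (hPub : Summit.BirchSwinnertonDyer.BirchSwinnertonDyer.Theses.ByReductionTypeAtTwo.OrdPublishedInputsAtTwo)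
    (hIso : Summit.BirchSwinnertonDyer.BirchSwinnertonDyer.Theses.ByReductionTypeAtTwo.OrdIsoPublishedInputsAtTwo)
    (hAU : abbesUllmo_not_dvd_maninConstant_of_not_dvd_level)
    (hT2 : exists_optimal_gamma1ParametrizationData)
    (hLam : R212Text) :
    Summit.BirchSwinnertonDyer.BirchSwinnertonDyer.Theorems.OrdHalvesAtTwo.OrdMissingLowerBoundAtTwo :=
  routeDecl19577_of_r213_inputs hPub hIso hAU hT2 hLam

#print axioms routeDecl19577_of_r213_inputs
#print axioms Summit.BirchSwinnertonDyer.BirchSwinnertonDyer.Theorems.KatoFreeSandwich.ordMissingLowerBoundAtTwo_of_published_of_lambdaHalf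

/-! ## (Q4) p671201 — the image split, against 19556's REGISTERED stub text -/

section ImageSplit
open Literature.NumberTheory.EllipticCurves.Rank1Residual                                  -- skeleton l.125: `GoodOrd`
open Summit.BirchSwinnertonDyer.BirchSwinnertonDyer.Theorems.TwoAdicTwistConverse (LambdaHalfAtTwo)  -- skeleton l.128

/-- BYTE COPY of the ledger `signature` of 19556's active stub `stub_irreducibleResidual` (workitem payload.stubs,
skeleton sha f29bb7b89845, 2026-08-28T19:58:21Z), elaborated under the skeleton's opens. -/
def StubIrrText19556 : Prop :=
  ∀ (W : WeierstrassCurve ℚ) [W.IsElliptic] [W.IsGloballyMinimal], ¬ W.HasCM → GoodOrd W 2 → W.HasIrreducibleModPGaloisRep 2 → LambdaHalfAtTwo W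

/-- The complementary (`E[2]`-reducible) branch text of p671201 (NOT a registered item or stub anywhere: it is the union of
19556's stubs 3–6 = the Kato–Greenberg / `W̄`-step / GL₁ branch, stated per curve). -/
def RedBranchText : Prop :=
  ∀ (W : WeierstrassCurve ℚ) [W.IsElliptic] [W.IsGloballyMinimal], ¬ W.HasCM → GoodOrd W 2 → ¬ W.HasIrreducibleModPGaloisRep 2 → LambdaHalfAtTwo W

/-- (Q4a) the two branch texts re-assemble to r212 = item 19556, definitionally up to excluded middle (p671201's own
`ordLambdaHalfAtTwo_iff_irr_and_red`, composed with `Iff.rfl`). -/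
theorem r212_iff_stubIrr_and_red : R212Text ↔ (StubIrrText19556 ∧ RedBranchText) :=
  Summit.BirchSwinnertonDyer.BirchSwinnertonDyer.Theorems.KatoFreeSandwich.ordLambdaHalfAtTwo_iff_irr_and_red

/-- (Q4b) the `E[2]`-IRREDUCIBLE branch of item 19577, per curve, from PUB ∧ Abbes–Ullmo ∧ 19556's registered stub text ONLY
(no Cassels, no T2, no selector): the stub text is accepted VERBATIM as p671201's `hΛirr`. -/
theorem irrBranch19577_of_stubIrr
    (hPub : Summit.BirchSwinnertonDyer.BirchSwinnertonDyer.Theses.ByReductionTypeAtTwo.OrdPublishedInputsAtTwo)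
    (hAU : abbesUllmo_not_dvd_maninConstant_of_not_dvd_level)
    (hI : StubIrrText19556)
    (W : WeierstrassCurve ℚ) [W.IsElliptic] [W.IsGloballyMinimal] (hcm : ¬ W.HasCM) (hr : W.analyticRank = 0)
    (hgo : GoodOrd W 2) (hirr : W.HasIrreducibleModPGaloisRep 2) :
    Literature.NumberTheory.EllipticCurves.Rank1Residual.Typed.MissingLowerBoundAt W 2 :=
  Summit.BirchSwinnertonDyer.BirchSwinnertonDyer.Theorems.KatoFreeSandwich.missingLowerBoundAt_two_of_irr_of_lambdaHalfIrr
    hPub hAU hI W hcm hr hgo hirr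

/-- (Q4c) the ITEM decl of 19577 from PUB ∧ Cassels(`.1` of the iso-published inputs) ∧ Abbes–Ullmo ∧ T2 ∧ the two branch
texts — p671201's §4, by full name. -/
theorem itemDecl19577_of_imageSplit_inputs
    (hPub : Summit.BirchSwinnertonDyer.BirchSwinnertonDyer.Theses.ByReductionTypeAtTwo.OrdPublishedInputsAtTwo)
    (hIso : Summit.BirchSwinnertonDyer.BirchSwinnertonDyer.Theses.ByReductionTypeAtTwo.OrdIsoPublishedInputsAtTwo)
    (hAU : abbesUllmo_not_dvd_maninConstant_of_not_dvd_level)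
    (hT2 : exists_optimal_gamma1ParametrizationData)
    (hI : StubIrrText19556) (hR : RedBranchText) :
    Summit.BirchSwinnertonDyer.BirchSwinnertonDyer.Theorems.OrdHalvesAtTwo.OrdMissingLowerBoundAtTwo :=
  Summit.BirchSwinnertonDyer.BirchSwinnertonDyer.Theorems.KatoFreeSandwich.ordMissingLowerBoundAtTwo_of_lambdaHalfIrr_of_lambdaHalfRed
    hPub hIso.1 hAU hT2 hI hR

/-- (Q4d) consistency: the split route and the unsplit route (Q2') agree — from r212 one gets both branch texts. -/
theorem itemDecl19577_of_r213_inputs'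
    (hPub : Summit.BirchSwinnertonDyer.BirchSwinnertonDyer.Theses.ByReductionTypeAtTwo.OrdPublishedInputsAtTwo)
    (hIso : Summit.BirchSwinnertonDyer.BirchSwinnertonDyer.Theses.ByReductionTypeAtTwo.OrdIsoPublishedInputsAtTwo)
    (hAU : abbesUllmo_not_dvd_maninConstant_of_not_dvd_level)
    (hT2 : exists_optimal_gamma1ParametrizationData)
    (hLam : R212Text) :
    Summit.BirchSwinnertonDyer.BirchSwinnertonDyer.Theorems.OrdHalvesAtTwo.OrdMissingLowerBoundAtTwo :=
  itemDecl19577_of_imageSplit_inputs hPub hIso hAU hT2 (r212_iff_stubIrr_and_red.mp hLam).1 (r212_iff_stubIrr_and_red.mp hLam).2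

#print axioms itemDecl19577_of_imageSplit_inputs
#print axioms irrBranch19577_of_stubIrr

end ImageSplit

end TriageR13ProbeP3
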